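import Literature.Geometry.Kaehler.ComplexTorusSymplecticGramPresentation
import Literature.Geometry.Kaehler.ComplexTorusAnalyticClassesPowersConditionD
import Literature.Geometry.Kaehler.ComplexTorusHodgeGeneralTimesSmallFactor
import Literature.Geometry.Kaehler.ComplexTorusHodgeGroupSymplecticRealComplex
import Literature.Geometry.Kaehler.ComplexTorusHomRankEquality
import Literature.Geometry.Kaehler.ComplexTorusPicardNumberOneEndomorphisms
import HarnessLib

/-!
# A Hodge-general abelian variety times a small factor, INTRINSICALLY: for EVERY abelian variety `X₁` with `End_ℚ(X₁) = ℚ`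
# and condition (D) (any presentation, any polarisation) and every `X₂` with `dim Hg(X₂) < g₁(2g₁+1)` — in particular
# `(2 dim X₂)² ≤ g₁(2g₁+1)`, or `Hg(X₂)` solvable, or `X₂` of CM type — `Hom = 0`, `ρ` is additive and (D) holds on all
# powers of `X₁ × X₂`; every abelian THREEFOLD `T` with `End_ℚ(T) = ℚ` against every abelian surface and every elliptic
# curve (Moonen–Zarhin (0.2)(4), (0.3)(4)); two such factors of different dimensions

Layer `Literature/Geometry/Kaehler`, namespace `Literature.Geometry.Kaehler.ComplexTorus`; lane `lit-hodgefound`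
(Track 2, Layer A4), seat `lit-hodgefound-skel-4`, row A4-128 of `run/shared/lean/pub/lit-hodgefound/SKELETON.md`.
THEOREMS ONLY (no `def`, no named fact, no instance, no notation; net debt `0`).

THE POINT. Row A4-125 (`ComplexTorusHodgeGeneralTimesSmallFactor`) and `ComplexTorusHodgeGroupSymplecticRealComplex` §3
prove Moonen–Zarhin's (3.1) / Gordon's §2.16 lemma and Hazama's product theorem in the lane's (D)-currency for a first
factor `X₁` PRESENTED on `l ⊕ l` with Gram matrix `J` (`hG₁ : (Matrix.J l ℚ).map Rat.cast = latticeGram Φ₁ η₁`). Row A4-127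
(`ComplexTorusSymplecticGramPresentation`) shows that EVERY abelian variety with `End_ℚ = ℚ` and (D) is ISOGENOUS to such
a presentation with the same two properties (`IsAbelianVariety.exists_isIsogenous_J_of_endAlgRat_eq_bot`: Prop. 2.1.2 +
the symplectic basis + isogeny invariance of `End_ℚ` and of (D)). Since `X₁ × X₂ ∼ X₁' × X₂` (`IsIsogenous.prod`), (D) on all
powers (`IsIsogenous.forall_powPeriod_divisorClasses_eq_hodgeClasses_iff`), `dim_ℚ Hom_ℚ` (`IsIsogenous.finrank_homRat_eq_left`
/ `_right`) and `ρ` are isogeny invariants, all the consequences become INTRINSIC statements about `IsAbelianVariety Φ₁`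
with `endAlgRat Φ₁ = ⊥`, in terms of `g₁ = dim_ℂ E₁`:

* §1 the engine: **`IsAbelianVariety.forall_divisorClasses_powPeriod_prod_eq_hodgeClasses_of_endAlgRat_eq_bot_of_zdim_lt`**
  (`X₁` abelian, `End_ℚ(X₁) = ℚ`, (D) on all powers of `X₁` and of `X₂`, `dim Hg(X₂) < g₁(2g₁+1)` ⟹ (D) on all powers of
  `X₁ × X₂`), the numerical form **`…_of_card_sq_le`** (`(2g₂)² ≤ g₁(2g₁+1)`, since `dim Hg(X₂) ≤ (2g₂)² − 1`), the solvable
  form `…_of_isSolvable`, the CM form `…_of_isCMType`, the `Hg(X₁) = Sp(V, E)` (real points) forms; **`Hom_ℚ(X₁, X₂) = 0 =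
  Hom_ℚ(X₂, X₁)`** and **`ρ(X₁ × X₂) = ρ(X₁) + ρ(X₂) = 1 + ρ(X₂)`** under `dim Hg(X₂) < g₁(2g₁+1)`; the cycle form
  `Aᵖ(Y) = Bᵖ(Y)` for inner-product tori `Y ∼ (X₁ × X₂)ᵏ`, `Y ∼ X₁ᵃ × X₂ᵇ`;
* §2 two Hodge-general abelian varieties of DIFFERENT dimensions: (D) on all powers of `X₁ × X₂`;
* §3 **every abelian threefold `T` with `End_ℚ(T) = ℚ` against EVERY abelian surface `S`** (Moonen–Zarhin Thm. (0.3)(4):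
  `T × S` is not among the exceptional fivefolds (e), (f), (g), all of which need a CM elliptic curve `X₁` with
  `k ↪ End⁰` of a simple threefold): (D) on all powers of `T × S`, `Hom = 0`, `ρ(T × S) = 1 + ρ(S)`, the cycle form — `T` is
  stably nondegenerate by the tree's `IsAbelianVariety.forall_divisorClasses_eq_hodgeClasses_powPeriod_of_finrank_eq_three_of_endAlgRat_eq_bot`
  (Moonen–Zarhin (2.3), `g = 3`), `S` by `IsAbelianVariety.forall_divisorClasses_powPeriod_eq_hodgeClasses_of_finrank_eq_two`
  (§3 of the paper), and `dim Hg(S) ≤ 15 < 21`;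
* §4 **`T × E_τ` for every elliptic curve** (Thm. (0.2)(4): not case (a), which needs `k ↪ End⁰(T) = ℚ`), and more generally
  every stably nondegenerate abelian variety of dimension `≥ 2` with `End_ℚ = ℚ` against any elliptic curve: (D) on all powers,
  `Hom = 0`, `ρ = 2`.

## Sources, verbatim

* B. Moonen, Yu. G. Zarhin, *Hodge classes on abelian varieties of low dimension*, Math. Ann. 315 (1999) [held
  arXiv:math/9901113]: Thm. (0.2) [p0001 L124–L152] "(a) The abelian variety `X` is isogenous to a product `X₁ × X₂` where
  `X₁` is an elliptic curve with complex multiplication by an imaginary quadratic field `k` and where `X₂` is a simple abelian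
  threefold such that there exists an embedding `k ↪ End⁰(X₂)` … (4) Suppose we are not in one of the cases (a), (b), (c)
  or (d). Then `Hg(X) = Sp_D(V,φ)` and `B•(Xⁿ) = D•(Xⁿ)` for all `n`."; Thm. (0.3) (4) [p0002 L1–L7] "Suppose we are not in
  one of the cases (e), (f) or (g) … if `X` has no simple factor of dimension 4 then `Hg(X) = Sp_D(V,φ)` and
  `B•(Xⁿ) = D•(Xⁿ)` for every `n ≥ 1`."; §3 (3.1) [p0006 L52–L60], Thm. (3.2) (1) (Hazama), Prop. (3.8); §3 [p0008 L108–L111]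
  "for every complex abelian variety `X` of dimension `≤ 3` we have `Hg(X) = Sp_D(V,φ)` and condition (D) in (1.5) is
  satisfied"; §1 [p0002 L129] "`Hg(X) ⊂ Sp_D(V,φ)`".
* B. B. Gordon, *A survey of the Hodge conjecture for abelian varieties* (1997/1999), §2.16 Proposition, Thm. 6.3, Thm. 7.5,
  Thm. 7.6.2, 7.6.1.
* H. Lange, *Abelian Varieties over the Complex Numbers* (2023) [held]: §2.1.1 Prop. 2.1.2 [p0076], §2.4.4 Cor. 2.4.26,
  §7.3.1 Thm. 7.3.1, Prop. 7.3.2, p. 336, §7.3.3 Exercise (1)(b) [p0341], (2)(c), (3)(a).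
* K. Hulek, R. Laface, *On the Picard numbers of abelian varieties* (2019), §2.1 Cor. 2.3
  (`ρ(X₁ × X₂) = ρ(X₁) + ρ(X₂) + rank Hom(X₁, X₂)`).

## References

* [MoonenZarhin1999LowDim] B. Moonen, Yu. G. Zarhin, Math. Ann. 315 (1999) 711–733, Thm. (0.2), Thm. (0.3), §1, §3
  (3.1), Thm. (3.2), Prop. (3.8).
* [Gordon1997] B. B. Gordon, arXiv:alg-geom/9709030, §2.16 Proposition, Thm. 7.5, 7.6.
* [Gordon1999HodgeAVSurvey] the same, Appendix B in J. D. Lewis, *A Survey of the Hodge Conjecture*, 2nd ed. (1999).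
* [Lange2023AbelianVarietiesComplex] H. Lange, *Abelian Varieties over the Complex Numbers*, Springer (2023), §2.1.1
  Prop. 2.1.2, §2.4.4 Cor. 2.4.26, §7.3.1, §7.3.3 Exercise (1), (2), (3).
* [HulekLaface2019PicardNumbersAV] K. Hulek, R. Laface, Ann. Sc. Norm. Super. Pisa (5) XIX (2019), §2.1 Cor. 2.3.
-/

noncomputable section

open scoped Manifold
open Module Matrix Set Function
open Literature.NumberTheory.Automorphic (IsZConnected)

universe u

namespace Literature.Geometry.Kaehler

namespace ComplexTorus

/-- A complex torus of positive dimension has a non-empty lattice index type. [cite: Lange2023AbelianVarietiesComplex, §1.1.2 (p. 18)] -/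
private theorem nonempty_of_finrank_pos₁₂₈ {ι : Type*} [Fintype ι] {E : Type*} [NormedAddCommGroup E] [NormedSpace ℂ E]
    [FiniteDimensional ℂ E] (Φ : (ι → ℝ) ≃L[ℝ] E) (h : 0 < finrank ℂ E) : Nonempty ι := by
  have hc := card_eq_two_mul_finrank Φ
  exact Fintype.card_pos_iff.1 (by omega)

/-- `dim Hg(X₂) < g₁(2g₁+1)` as soon as `(2g₂)² ≤ g₁(2g₁+1)` (`dim Hg(X₂) ≤ (2g₂)² − 1`, the tree's `zdim_map_toGL_hodgeGroupC_le`).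
[cite: MoonenZarhin1999LowDim, §1 (p0002 L129)] [cite: Gordon1997, §2.16 Proposition] -/
private theorem zdim_lt_of_card_sq_le₁₂₈ {ι₂ : Type*} [Fintype ι₂] [DecidableEq ι₂] [Nonempty ι₂] {E₂ : Type*}
    [NormedAddCommGroup E₂] [NormedSpace ℂ E₂] (Φ₂ : (ι₂ → ℝ) ≃L[ℝ] E₂) {N : ℕ} (hcard : Fintype.card ι₂ ^ 2 ≤ N) :
    (isZConnected_map_toGL_hodgeGroupC Φ₂).zdim < N := by
  have h1 := zdim_map_toGL_hodgeGroupC_le Φ₂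
  have h2 : 0 < Fintype.card ι₂ := Fintype.card_pos
  have h3 : 0 < Fintype.card ι₂ ^ 2 := pow_pos h2 2
  omega

/-! ## §1 The engine: `X₁` any abelian variety with `End_ℚ(X₁) = ℚ` and (D); `dim Hg(X₂) < g₁(2g₁+1)` -/

section Intrinsic

variable {ι₁ ι₂ : Type*} [Fintype ι₁] [DecidableEq ι₁] [Fintype ι₂] [DecidableEq ι₂]
  {E₁ E₂ : Type*} [NormedAddCommGroup E₁] [NormedSpace ℂ E₁] [FiniteDimensional ℂ E₁] [NormedAddCommGroup E₂]
  [NormedSpace ℂ E₂] {Φ₁ : (ι₁ → ℝ) ≃L[ℝ] E₁} (Φ₂ : (ι₂ → ℝ) ≃L[ℝ] E₂) [Nonempty ι₁]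

/-- **HAZAMA–MURTY / MOONEN–ZARHIN (3.1), INTRINSIC FORM: `X₁` ANY abelian variety with `End_ℚ(X₁) = ℚ` and (D) on all its
powers, `X₂` any complex torus with (D) on all its powers and `dim Hg(X₂) < g₁(2g₁+1)` (`g₁ = dim X₁`) ⟹ (D) on all powers of
`X₁ × X₂`** — by transport along `X₁ ∼ X₁'`, `X₁'` a principal `J`-presentation (row A4-127), to the `J`-theorem of
`ComplexTorusHodgeGroupSymplecticRealComplex`. [cite: MoonenZarhin1999LowDim, §3 (3.1) and Thm. (3.2) (1)]
[cite: Gordon1999HodgeAVSurvey, Thm. 7.5 and Thm. 7.6.2] [cite: Lange2023AbelianVarietiesComplex, §2.1.1 Prop. 2.1.2 and §7.3.3 Exercise (1)(b)] -/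
theorem IsAbelianVariety.forall_divisorClasses_powPeriod_prod_eq_hodgeClasses_of_endAlgRat_eq_bot_of_zdim_lt
    (hA₁ : IsAbelianVariety Φ₁) (hE₁ : endAlgRat Φ₁ = ⊥)
    (hX₁ : ∀ k p, divisorClasses (powPeriod Φ₁ k) p = hodgeClasses (powPeriod Φ₁ k) p)
    (hlt : (isZConnected_map_toGL_hodgeGroupC Φ₂).zdim < finrank ℂ E₁ * (2 * finrank ℂ E₁ + 1))
    (hX₂ : ∀ k p, divisorClasses (powPeriod Φ₂ k) p = hodgeClasses (powPeriod Φ₂ k) p) :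
    ∀ k p, divisorClasses (powPeriod (prodPeriod Φ₁ Φ₂) k) p = hodgeClasses (powPeriod (prodPeriod Φ₁ Φ₂) k) p := by
  obtain ⟨g, Ψ, η, hiso, hp, hG, hg, hg0, hEΨ, hDΨ⟩ := hA₁.exists_isIsogenous_J_of_endAlgRat_eq_bot Φ₁ hE₁ hX₁
  haveI : Nonempty (Fin g) := ⟨⟨0, hg0⟩⟩
  have hlt' : (isZConnected_map_toGL_hodgeGroupC Φ₂).zdim < Fintype.card (Fin g) * (2 * Fintype.card (Fin g) + 1) := by
    rwa [Fintype.card_fin, ← hg]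
  have key := hp.isRiemannForm.forall_divisorClasses_powPeriod_prod_eq_hodgeClasses_of_endAlgRat_eq_bot_of_zdim_lt Φ₂ hG
    hEΨ hDΨ hlt' hX₂
  exact (hiso.prod (IsIsogenous.refl Φ₂)).forall_powPeriod_divisorClasses_eq_hodgeClasses_iff.2 key

/-- **The numerical form: `(2g₂)² ≤ g₁(2g₁+1)` suffices** (`dim Hg(X₂) ≤ (2g₂)² − 1` for every torus `X₂`): `g₂ = 1, g₁ ≥ 2`;
`g₂ = 2, g₁ ≥ 3`; `g₂ = 3, g₁ ≥ 4`; … [cite: MoonenZarhin1999LowDim, §3 (3.1), Thm. (3.2) (1) and §1 (p0002 L129)]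
[cite: Gordon1997, §2.16 Proposition] [cite: Gordon1999HodgeAVSurvey, Thm. 7.5 and Thm. 7.6.2] -/
theorem IsAbelianVariety.forall_divisorClasses_powPeriod_prod_eq_hodgeClasses_of_endAlgRat_eq_bot_of_card_sq_le [Nonempty ι₂]
    (hA₁ : IsAbelianVariety Φ₁) (hE₁ : endAlgRat Φ₁ = ⊥)
    (hX₁ : ∀ k p, divisorClasses (powPeriod Φ₁ k) p = hodgeClasses (powPeriod Φ₁ k) p)
    (hcard : Fintype.card ι₂ ^ 2 ≤ finrank ℂ E₁ * (2 * finrank ℂ E₁ + 1))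
    (hX₂ : ∀ k p, divisorClasses (powPeriod Φ₂ k) p = hodgeClasses (powPeriod Φ₂ k) p) :
    ∀ k p, divisorClasses (powPeriod (prodPeriod Φ₁ Φ₂) k) p = hodgeClasses (powPeriod (prodPeriod Φ₁ Φ₂) k) p :=
  hA₁.forall_divisorClasses_powPeriod_prod_eq_hodgeClasses_of_endAlgRat_eq_bot_of_zdim_lt Φ₂ hE₁ hX₁
    (zdim_lt_of_card_sq_le₁₂₈ Φ₂ hcard) hX₂

/-- **`Hg(X₁) = Sp(V, E)` form** (real points, ANY polarisation `η₁` of any presentation): `Hg(X₁) = Sp(V₁, E₁)`, (D) on all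
powers of `X₂` and `dim Hg(X₂) < g₁(2g₁+1)` ⟹ (D) on all powers of `X₁ × X₂` (Gordon 7.5: `Hg = Sp ⟺ End_ℚ = ℚ` and stably
nondegenerate). [cite: MoonenZarhin1999LowDim, §3 (3.1) and Thm. (3.2) (1)] [cite: Gordon1999HodgeAVSurvey, Thm. 7.5 and Thm. 7.6.2]
[cite: Lange2023AbelianVarietiesComplex, §7.3.1 Prop. 7.3.2] -/
theorem IsRiemannForm.forall_divisorClasses_powPeriod_prod_eq_hodgeClasses_of_hodgeGroup_eq_spGroup_of_zdim_lt
    {η₁ : E₁ [⋀^Fin 2]→L[ℝ] ℝ} (hη₁ : IsRiemannForm Φ₁ η₁) (h₁ : hodgeGroup Φ₁ = spGroup Φ₁ η₁)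
    (hlt : (isZConnected_map_toGL_hodgeGroupC Φ₂).zdim < finrank ℂ E₁ * (2 * finrank ℂ E₁ + 1))
    (hX₂ : ∀ k p, divisorClasses (powPeriod Φ₂ k) p = hodgeClasses (powPeriod Φ₂ k) p) :
    ∀ k p, divisorClasses (powPeriod (prodPeriod Φ₁ Φ₂) k) p = hodgeClasses (powPeriod (prodPeriod Φ₁ Φ₂) k) p := by
  have h := (hη₁.hodgeGroup_eq_spGroup_iff_forall_divisorClasses_eq_hodgeClasses_and_endAlgRat_eq_bot).1 h₁
  exact IsAbelianVariety.forall_divisorClasses_powPeriod_prod_eq_hodgeClasses_of_endAlgRat_eq_bot_of_zdim_lt Φ₂ ⟨η₁, hη₁⟩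
    h.2 h.1 hlt hX₂

/-- **`Hg(X₂)(ℂ)` SOLVABLE form** (Gordon's lemma, §3 of the 1997 survey; Moonen–Zarhin Thm. (3.2) (2)): `X₁` abelian with
`End_ℚ(X₁) = ℚ` and (D) on all powers, `Hg(X₂)(ℂ)` solvable, (D) on all powers of `X₂` ⟹ (D) on all powers of `X₁ × X₂`.
[cite: MoonenZarhin1999LowDim, §3 Theorem (2)] [cite: Gordon1997, §2.16 Proposition and §3 Theorem, proof]
[cite: Gordon1999HodgeAVSurvey, Thm. 7.5 and Thm. 7.6.2] -/
theorem IsAbelianVariety.forall_divisorClasses_powPeriod_prod_eq_hodgeClasses_of_endAlgRat_eq_bot_of_isSolvable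
    (hA₁ : IsAbelianVariety Φ₁) (hE₁ : endAlgRat Φ₁ = ⊥)
    (hX₁ : ∀ k p, divisorClasses (powPeriod Φ₁ k) p = hodgeClasses (powPeriod Φ₁ k) p)
    (h₂ : IsSolvable ↥(hodgeGroupC Φ₂))
    (hX₂ : ∀ k p, divisorClasses (powPeriod Φ₂ k) p = hodgeClasses (powPeriod Φ₂ k) p) :
    ∀ k p, divisorClasses (powPeriod (prodPeriod Φ₁ Φ₂) k) p = hodgeClasses (powPeriod (prodPeriod Φ₁ Φ₂) k) p := by
  obtain ⟨g, Ψ, η, hiso, hp, hG, hg, hg0, hEΨ, hDΨ⟩ := hA₁.exists_isIsogenous_J_of_endAlgRat_eq_bot Φ₁ hE₁ hX₁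
  haveI : Nonempty (Fin g) := ⟨⟨0, hg0⟩⟩
  have key := hp.isRiemannForm.forall_divisorClasses_powPeriod_prod_eq_hodgeClasses_of_endAlgRat_eq_bot_of_isSolvable Φ₂
    hG hEΨ hDΨ h₂ hX₂
  exact (hiso.prod (IsIsogenous.refl Φ₂)).forall_powPeriod_divisorClasses_eq_hodgeClasses_iff.2 key

variable {Φ₂} in
/-- **CM SECOND FACTOR**: `X₁` abelian with `End_ℚ(X₁) = ℚ` and (D) on all powers, `X₂` an abelian variety of CM-type with (D)
on all its powers ⟹ (D) on all powers of `X₁ × X₂` (Hazama; Moonen–Zarhin Thm. (3.2) (2)).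
[cite: MoonenZarhin1999LowDim, §3 Theorem (2)] [cite: Gordon1999HodgeAVSurvey, Thm. 7.5 and Thm. 7.6.2] [cite: Gordon1997, §2.12 Proposition] -/
theorem IsAbelianVariety.forall_divisorClasses_powPeriod_prod_eq_hodgeClasses_of_endAlgRat_eq_bot_of_isCMType
    (hA₁ : IsAbelianVariety Φ₁) (hE₁ : endAlgRat Φ₁ = ⊥)
    (hX₁ : ∀ k p, divisorClasses (powPeriod Φ₁ k) p = hodgeClasses (powPeriod Φ₁ k) p) (hA₂ : IsAbelianVariety Φ₂)
    (hCM : ∃ T : Subalgebra ℚ (Matrix ι₂ ι₂ ℚ), T ≤ endAlgRat Φ₂ ∧ IsReduced T ∧ (∀ a ∈ T, ∀ b ∈ T, a * b = b * a) ∧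
      Module.finrank ℚ T = Fintype.card ι₂)
    (hX₂ : ∀ k p, divisorClasses (powPeriod Φ₂ k) p = hodgeClasses (powPeriod Φ₂ k) p) :
    ∀ k p, divisorClasses (powPeriod (prodPeriod Φ₁ Φ₂) k) p = hodgeClasses (powPeriod (prodPeriod Φ₁ Φ₂) k) p := by
  obtain ⟨g, Ψ, η, hiso, hp, hG, hg, hg0, hEΨ, hDΨ⟩ := hA₁.exists_isIsogenous_J_of_endAlgRat_eq_bot Φ₁ hE₁ hX₁
  haveI : Nonempty (Fin g) := ⟨⟨0, hg0⟩⟩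
  have key := hp.isRiemannForm.forall_divisorClasses_powPeriod_prod_eq_hodgeClasses_of_endAlgRat_eq_bot_of_isCMType hG
    hEΨ hDΨ hA₂ hCM hX₂
  exact (hiso.prod (IsIsogenous.refl Φ₂)).forall_powPeriod_divisorClasses_eq_hodgeClasses_iff.2 key

/-- **`Hom_ℚ(X₁, X₂) = 0`**: `X₁` abelian with `End_ℚ(X₁) = ℚ` and (D) on all powers, `dim Hg(X₂) < g₁(2g₁+1)` (the Hodge group
of `X₁' × X₂` splits for the `J`-model `X₁' ∼ X₁`, so `Hom_ℚ(X₁', X₂) = 0`, and `dim_ℚ Hom_ℚ` is an isogeny invariant).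
[cite: MoonenZarhin1999LowDim, §3 (3.1) and Prop. (3.8)] [cite: Gordon1997, §2.16 Proposition] [cite: Lange2023AbelianVarietiesComplex, §1.1.2 Cor. 1.1.16] -/
theorem IsAbelianVariety.homRat_eq_bot_of_endAlgRat_eq_bot_of_zdim_lt (hA₁ : IsAbelianVariety Φ₁) (hE₁ : endAlgRat Φ₁ = ⊥)
    (hX₁ : ∀ k p, divisorClasses (powPeriod Φ₁ k) p = hodgeClasses (powPeriod Φ₁ k) p)
    (hlt : (isZConnected_map_toGL_hodgeGroupC Φ₂).zdim < finrank ℂ E₁ * (2 * finrank ℂ E₁ + 1)) : homRat Φ₁ Φ₂ = ⊥ := by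
  obtain ⟨g, Ψ, η, hiso, hp, hG, hg, hg0, hEΨ, hDΨ⟩ := hA₁.exists_isIsogenous_J_of_endAlgRat_eq_bot Φ₁ hE₁ hX₁
  haveI : Nonempty (Fin g) := ⟨⟨0, hg0⟩⟩
  have hlt' : (isZConnected_map_toGL_hodgeGroupC Φ₂).zdim < Fintype.card (Fin g) * (2 * Fintype.card (Fin g) + 1) := by
    rwa [Fintype.card_fin, ← hg]
  have hsplit := hodgeGroupC_prod_eq_blockDiagProd_of_eq_symplecticGroupC_of_zdim_lt Ψ Φ₂
    (hp.isRiemannForm.hodgeGroupC_eq_symplecticGroupC_of_forall_divisorClasses_eq_hodgeClasses hG hEΨ hDΨ) hlt'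
  have h0 := homRat_eq_bot_of_hodgeGroupC_prod_eq_blockDiagProd Ψ Φ₂ hsplit
  rw [← Submodule.finrank_eq_zero, hiso.finrank_homRat_eq_left Φ₂, h0, finrank_bot]

/-- **`Hom_ℚ(X₂, X₁) = 0`** likewise. [cite: MoonenZarhin1999LowDim, §3 (3.1) and Prop. (3.8)] [cite: Gordon1997, §2.16 Proposition]
[cite: Lange2023AbelianVarietiesComplex, §1.1.2 Cor. 1.1.16] -/
theorem IsAbelianVariety.homRat_eq_bot_of_endAlgRat_eq_bot_of_zdim_lt' (hA₁ : IsAbelianVariety Φ₁) (hE₁ : endAlgRat Φ₁ = ⊥)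
    (hX₁ : ∀ k p, divisorClasses (powPeriod Φ₁ k) p = hodgeClasses (powPeriod Φ₁ k) p)
    (hlt : (isZConnected_map_toGL_hodgeGroupC Φ₂).zdim < finrank ℂ E₁ * (2 * finrank ℂ E₁ + 1)) : homRat Φ₂ Φ₁ = ⊥ := by
  obtain ⟨g, Ψ, η, hiso, hp, hG, hg, hg0, hEΨ, hDΨ⟩ := hA₁.exists_isIsogenous_J_of_endAlgRat_eq_bot Φ₁ hE₁ hX₁
  haveI : Nonempty (Fin g) := ⟨⟨0, hg0⟩⟩
  have hlt' : (isZConnected_map_toGL_hodgeGroupC Φ₂).zdim < Fintype.card (Fin g) * (2 * Fintype.card (Fin g) + 1) := by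
    rwa [Fintype.card_fin, ← hg]
  have hsplit := hodgeGroupC_prod_eq_blockDiagProd_of_eq_symplecticGroupC_of_zdim_lt Ψ Φ₂
    (hp.isRiemannForm.hodgeGroupC_eq_symplecticGroupC_of_forall_divisorClasses_eq_hodgeClasses hG hEΨ hDΨ) hlt'
  have h0 := homRat_eq_bot_of_hodgeGroupC_prod_eq_blockDiagProd' Ψ Φ₂ hsplit
  rw [← Submodule.finrank_eq_zero, IsIsogenous.finrank_homRat_eq_right Φ₂ hiso, h0, finrank_bot]

/-- **`Hom_ℚ(X₁, X₂) = 0 = Hom_ℚ(X₂, X₁)` under `(2g₂)² ≤ g₁(2g₁+1)`.** [cite: MoonenZarhin1999LowDim, §3 (3.1) and Prop. (3.8)]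
[cite: Gordon1997, §2.16 Proposition] -/
theorem IsAbelianVariety.homRat_eq_bot_and_of_endAlgRat_eq_bot_of_card_sq_le [Nonempty ι₂] (hA₁ : IsAbelianVariety Φ₁)
    (hE₁ : endAlgRat Φ₁ = ⊥) (hX₁ : ∀ k p, divisorClasses (powPeriod Φ₁ k) p = hodgeClasses (powPeriod Φ₁ k) p)
    (hcard : Fintype.card ι₂ ^ 2 ≤ finrank ℂ E₁ * (2 * finrank ℂ E₁ + 1)) : homRat Φ₁ Φ₂ = ⊥ ∧ homRat Φ₂ Φ₁ = ⊥ :=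
  ⟨hA₁.homRat_eq_bot_of_endAlgRat_eq_bot_of_zdim_lt Φ₂ hE₁ hX₁ (zdim_lt_of_card_sq_le₁₂₈ Φ₂ hcard),
    hA₁.homRat_eq_bot_of_endAlgRat_eq_bot_of_zdim_lt' Φ₂ hE₁ hX₁ (zdim_lt_of_card_sq_le₁₂₈ Φ₂ hcard)⟩

/-- **`ρ(X₁ × X₂) = ρ(X₁) + ρ(X₂)`** under `dim Hg(X₂) < g₁(2g₁+1)` (`Hom = 0`, Hulek–Laface Cor. 2.3).
[cite: HulekLaface2019PicardNumbersAV, §2.1 Cor. 2.3] [cite: MoonenZarhin1999LowDim, §3 (3.1) and Prop. (3.8)] -/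
theorem IsAbelianVariety.finrank_neronSeveriGroup_prod_of_endAlgRat_eq_bot_of_zdim_lt [FiniteDimensional ℂ E₂]
    (hA₁ : IsAbelianVariety Φ₁) (hE₁ : endAlgRat Φ₁ = ⊥)
    (hX₁ : ∀ k p, divisorClasses (powPeriod Φ₁ k) p = hodgeClasses (powPeriod Φ₁ k) p)
    (hlt : (isZConnected_map_toGL_hodgeGroupC Φ₂).zdim < finrank ℂ E₁ * (2 * finrank ℂ E₁ + 1)) :
    finrank ℤ (neronSeveriGroup (prodPeriod Φ₁ Φ₂)) = finrank ℤ (neronSeveriGroup Φ₁) + finrank ℤ (neronSeveriGroup Φ₂) :=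
  hA₁.finrank_neronSeveriGroup_prod_of_homRat_eq_bot Φ₂ (hA₁.homRat_eq_bot_of_endAlgRat_eq_bot_of_zdim_lt' Φ₂ hE₁ hX₁ hlt)

/-- **`ρ(X₁ × X₂) = 1 + ρ(X₂)`** under `dim Hg(X₂) < g₁(2g₁+1)` (`ρ(X₁) = 1` since `End_ℚ(X₁) = ℚ`: `NS_ℚ(X₁) ⊆ End_ℚ^s(X₁)`).
[cite: HulekLaface2019PicardNumbersAV, §2.1 Cor. 2.3 and Prop. 2.4] [cite: MoonenZarhin1999LowDim, §3 Prop. (3.8)] -/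
theorem IsAbelianVariety.finrank_neronSeveriGroup_prod_eq_one_add_of_endAlgRat_eq_bot_of_zdim_lt [FiniteDimensional ℂ E₂]
    (hA₁ : IsAbelianVariety Φ₁) (hE₁ : endAlgRat Φ₁ = ⊥)
    (hX₁ : ∀ k p, divisorClasses (powPeriod Φ₁ k) p = hodgeClasses (powPeriod Φ₁ k) p)
    (hlt : (isZConnected_map_toGL_hodgeGroupC Φ₂).zdim < finrank ℂ E₁ * (2 * finrank ℂ E₁ + 1)) :
    finrank ℤ (neronSeveriGroup (prodPeriod Φ₁ Φ₂)) = 1 + finrank ℤ (neronSeveriGroup Φ₂) := by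
  have hpos : 0 < finrank ℂ E₁ := by
    have hc := card_eq_two_mul_finrank Φ₁
    have : 0 < Fintype.card ι₁ := Fintype.card_pos
    omega
  haveI : Nontrivial E₁ := Module.nontrivial_of_finrank_pos hpos
  rw [hA₁.finrank_neronSeveriGroup_prod_of_endAlgRat_eq_bot_of_zdim_lt Φ₂ hE₁ hX₁ hlt,
    hA₁.finrank_neronSeveriGroup_eq_one_of_endAlgRat_eq_bot hE₁]

/-- **`ρ(X₁ × X₂) = ρ(X₁) + ρ(X₂)` under `(2g₂)² ≤ g₁(2g₁+1)`.** [cite: HulekLaface2019PicardNumbersAV, §2.1 Cor. 2.3]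
[cite: MoonenZarhin1999LowDim, §3 Prop. (3.8)] -/
theorem IsAbelianVariety.finrank_neronSeveriGroup_prod_of_endAlgRat_eq_bot_of_card_sq_le [FiniteDimensional ℂ E₂] [Nonempty ι₂]
    (hA₁ : IsAbelianVariety Φ₁) (hE₁ : endAlgRat Φ₁ = ⊥)
    (hX₁ : ∀ k p, divisorClasses (powPeriod Φ₁ k) p = hodgeClasses (powPeriod Φ₁ k) p)
    (hcard : Fintype.card ι₂ ^ 2 ≤ finrank ℂ E₁ * (2 * finrank ℂ E₁ + 1)) :
    finrank ℤ (neronSeveriGroup (prodPeriod Φ₁ Φ₂)) = finrank ℤ (neronSeveriGroup Φ₁) + finrank ℤ (neronSeveriGroup Φ₂) :=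
  hA₁.finrank_neronSeveriGroup_prod_of_endAlgRat_eq_bot_of_zdim_lt Φ₂ hE₁ hX₁ (zdim_lt_of_card_sq_le₁₂₈ Φ₂ hcard)

variable {κ : Type*} [Fintype κ] [DecidableEq κ] {E' : Type u} [NormedAddCommGroup E'] [InnerProductSpace ℂ E']
  [FiniteDimensional ℂ E'] [MeasurableSpace E'] [BorelSpace E'] (Ψ : (κ → ℝ) ≃L[ℝ] E') {q : ℕ} (e : Fin q ≃ κ)

/-- **The cycle form**: `X₁` abelian with `End_ℚ(X₁) = ℚ` and (D), `X₂` an ABELIAN VARIETY with (D) and `dim Hg(X₂) <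
g₁(2g₁+1)` ⟹ every inner-product torus `Y ∼ (X₁ × X₂)ᵏ` satisfies the Hodge `(p,p)`-conjecture `Aᵖ(Y) = Bᵖ(Y)` in every
codimension. [cite: MoonenZarhin1999LowDim, §1 (1.5) and §3 (3.1)] [cite: Lange2023AbelianVarietiesComplex, §7.3.1 (p. 336) and §7.3.3 Exercise (1)(b)] -/
theorem IsIsogenous.forall_analyticClasses_eq_hodgeClasses_of_powPeriod_prod_of_endAlgRat_eq_bot_of_zdim_lt {k : ℕ}
    (hY : IsIsogenous Ψ (powPeriod (prodPeriod Φ₁ Φ₂) k)) (hA₁ : IsAbelianVariety Φ₁) (hE₁ : endAlgRat Φ₁ = ⊥)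
    (hX₁ : ∀ k p, divisorClasses (powPeriod Φ₁ k) p = hodgeClasses (powPeriod Φ₁ k) p)
    (hlt : (isZConnected_map_toGL_hodgeGroupC Φ₂).zdim < finrank ℂ E₁ * (2 * finrank ℂ E₁ + 1)) (hA₂ : IsAbelianVariety Φ₂)
    (hX₂ : ∀ k p, divisorClasses (powPeriod Φ₂ k) p = hodgeClasses (powPeriod Φ₂ k) p) (p : ℕ) :
    analyticClasses Ψ e p = hodgeClasses Ψ p :=
  hY.forall_analyticClasses_eq_hodgeClasses_of_powPeriod_of_forall_powPeriod Ψ e (hA₁.prod hA₂)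
    (hA₁.forall_divisorClasses_powPeriod_prod_eq_hodgeClasses_of_endAlgRat_eq_bot_of_zdim_lt Φ₂ hE₁ hX₁ hlt hX₂) p

/-- The cycle form under `(2g₂)² ≤ g₁(2g₁+1)`, for inner-product tori `Y ∼ X₁ᵃ × X₂ᵇ`.
[cite: MoonenZarhin1999LowDim, §1 (1.5) and §3 (3.1)] [cite: Gordon1999HodgeAVSurvey, 7.6.1] [cite: Lange2023AbelianVarietiesComplex, §7.3.1 (p. 336)] -/
theorem IsIsogenous.forall_analyticClasses_eq_hodgeClasses_of_prod_powPeriod_of_endAlgRat_eq_bot_of_card_sq_le [Nonempty ι₂] {a b : ℕ}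
    (hY : IsIsogenous Ψ (prodPeriod (powPeriod Φ₁ a) (powPeriod Φ₂ b))) (hA₁ : IsAbelianVariety Φ₁) (hE₁ : endAlgRat Φ₁ = ⊥)
    (hX₁ : ∀ k p, divisorClasses (powPeriod Φ₁ k) p = hodgeClasses (powPeriod Φ₁ k) p)
    (hcard : Fintype.card ι₂ ^ 2 ≤ finrank ℂ E₁ * (2 * finrank ℂ E₁ + 1)) (hA₂ : IsAbelianVariety Φ₂)
    (hX₂ : ∀ k p, divisorClasses (powPeriod Φ₂ k) p = hodgeClasses (powPeriod Φ₂ k) p) (p : ℕ) :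
    analyticClasses Ψ e p = hodgeClasses Ψ p :=
  hY.forall_analyticClasses_eq_hodgeClasses_of_prod_powPeriod_of_forall_powPeriod Ψ e hA₁ hA₂
    (hA₁.forall_divisorClasses_powPeriod_prod_eq_hodgeClasses_of_endAlgRat_eq_bot_of_card_sq_le Φ₂ hE₁ hX₁ hcard hX₂) p

end Intrinsic

/-! ## §2 Two Hodge-general abelian varieties of different dimensions -/

section Two

variable {ι₁ ι₂ : Type*} [Fintype ι₁] [DecidableEq ι₁] [Fintype ι₂] [DecidableEq ι₂]
  {E₁ E₂ : Type*} [NormedAddCommGroup E₁] [NormedSpace ℂ E₁] [FiniteDimensional ℂ E₁] [NormedAddCommGroup E₂]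
  [NormedSpace ℂ E₂] [FiniteDimensional ℂ E₂] {Φ₁ : (ι₁ → ℝ) ≃L[ℝ] E₁} {Φ₂ : (ι₂ → ℝ) ≃L[ℝ] E₂} [Nonempty ι₁] [Nonempty ι₂]

/-- **TWO STABLY NONDEGENERATE ABELIAN VARIETIES WITH `End_ℚ = ℚ` OF DIFFERENT DIMENSIONS: `X₁ × X₂` IS STABLY
NONDEGENERATE**, intrinsically (both factors transported to `J`-presentations; `𝔰𝔭_{2g₁} ≇ 𝔰𝔭_{2g₂}`).
[cite: MoonenZarhin1999LowDim, §3 (3.1) and Thm. (3.2) (1)] [cite: Gordon1999HodgeAVSurvey, Thm. 7.5 and Thm. 7.6.2] [cite: Gordon1997, §2.16 Proposition] -/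
theorem IsAbelianVariety.forall_divisorClasses_powPeriod_prod_eq_hodgeClasses_of_endAlgRat_eq_bot_of_finrank_ne
    (hA₁ : IsAbelianVariety Φ₁) (hA₂ : IsAbelianVariety Φ₂) (hE₁ : endAlgRat Φ₁ = ⊥) (hE₂ : endAlgRat Φ₂ = ⊥)
    (hX₁ : ∀ k p, divisorClasses (powPeriod Φ₁ k) p = hodgeClasses (powPeriod Φ₁ k) p)
    (hX₂ : ∀ k p, divisorClasses (powPeriod Φ₂ k) p = hodgeClasses (powPeriod Φ₂ k) p)
    (hne : finrank ℂ E₁ ≠ finrank ℂ E₂) :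
    ∀ k p, divisorClasses (powPeriod (prodPeriod Φ₁ Φ₂) k) p = hodgeClasses (powPeriod (prodPeriod Φ₁ Φ₂) k) p := by
  obtain ⟨g₁, Ψ₁, η₁, hiso₁, hp₁, hG₁, hg₁, hg₁0, hEΨ₁, hDΨ₁⟩ := hA₁.exists_isIsogenous_J_of_endAlgRat_eq_bot Φ₁ hE₁ hX₁
  obtain ⟨g₂, Ψ₂, η₂, hiso₂, hp₂, hG₂, hg₂, hg₂0, hEΨ₂, hDΨ₂⟩ := hA₂.exists_isIsogenous_J_of_endAlgRat_eq_bot Φ₂ hE₂ hX₂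
  haveI : Nonempty (Fin g₁) := ⟨⟨0, hg₁0⟩⟩
  haveI : Nonempty (Fin g₂) := ⟨⟨0, hg₂0⟩⟩
  have hne' : Fintype.card (Fin g₁) ≠ Fintype.card (Fin g₂) := by rwa [Fintype.card_fin, Fintype.card_fin, ← hg₁, ← hg₂]
  have key := hp₁.isRiemannForm.forall_divisorClasses_powPeriod_prod_eq_hodgeClasses_of_endAlgRat_eq_bot_of_card_ne
    hp₂.isRiemannForm hG₁ hG₂ hEΨ₁ hEΨ₂ hDΨ₁ hDΨ₂ hne'
  exact (hiso₁.prod hiso₂).forall_powPeriod_divisorClasses_eq_hodgeClasses_iff.2 key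

end Two

/-! ## §3 Every abelian threefold `T` with `End_ℚ(T) = ℚ` against every abelian surface (Moonen–Zarhin Thm. (0.3)(4)) -/

section Threefold

variable {ι₁ : Type*} [Fintype ι₁] [DecidableEq ι₁] {ι₂ : Type} [Fintype ι₂] [DecidableEq ι₂]
  {E₁ : Type*} {E₂ : Type} [NormedAddCommGroup E₁] [NormedSpace ℂ E₁] [FiniteDimensional ℂ E₁] [NormedAddCommGroup E₂]
  [NormedSpace ℂ E₂] [FiniteDimensional ℂ E₂] {Φ₁ : (ι₁ → ℝ) ≃L[ℝ] E₁} (Φ₂ : (ι₂ → ℝ) ≃L[ℝ] E₂)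

omit [DecidableEq ι₂] [FiniteDimensional ℂ E₁] in
include Φ₂ in
/-- `(2·2)² = 16 ≤ 21 = 3·7`: an abelian surface is a small factor against a threefold. [folklore]
[cite: Lange2023AbelianVarietiesComplex, §1.1.2 (p. 18)] -/
theorem card_sq_le_of_finrank_eq_two_of_finrank_eq_three (h2 : finrank ℂ E₂ = 2) (h3 : finrank ℂ E₁ = 3) : Fintype.card ι₂ ^ 2 ≤ finrank ℂ E₁ * (2 * finrank ℂ E₁ + 1) := by
  have h := card_eq_two_mul_finrank Φ₂
  rw [h2] at h
  rw [h, h3]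
  norm_num

/-- **EVERY ABELIAN THREEFOLD `T` WITH `End_ℚ(T) = ℚ`, TIMES EVERY ABELIAN SURFACE `S` (simple or not, CM or not): every
power of the abelian fivefold `T × S` has its Hodge ring generated by divisor classes, `Dᵖ((T × S)ᵏ) = Bᵖ((T × S)ᵏ)`** —
Moonen–Zarhin Thm. (0.3)(4) for these fivefolds (no simple factor of dimension 4; not (e), (f), (g), which need a CM elliptic
curve with `k ↪ End⁰` of a simple threefold, impossible against `End_ℚ(T) = ℚ`): `T` is stably nondegenerate with
`Hg(T) = Sp₆` ((2.3), `g = 3`, `End_ℚ = ℚ`), `S` satisfies (D) (§3), `dim Hg(S) ≤ 15 < 21`.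
[cite: MoonenZarhin1999LowDim, Thm. (0.3) (4) (p0002 L1–L7), §2 (2.3), §3 (3.1), Thm. (3.2) (1) and §3 (p0008 L108–L111)]
[cite: Gordon1999HodgeAVSurvey, Thm. 6.3, Thm. 7.5 and Thm. 7.6.2] [cite: Lange2023AbelianVarietiesComplex, §7.3.3 Exercise (2)(c)] -/
theorem IsAbelianVariety.forall_divisorClasses_powPeriod_prod_eq_hodgeClasses_of_finrank_eq_three_of_endAlgRat_eq_bot_of_finrank_eq_two
    (hT : IsAbelianVariety Φ₁) (h3 : finrank ℂ E₁ = 3) (hE₁ : endAlgRat Φ₁ = ⊥) (hS : IsAbelianVariety Φ₂)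
    (h2 : finrank ℂ E₂ = 2) :
    ∀ k p, divisorClasses (powPeriod (prodPeriod Φ₁ Φ₂) k) p = hodgeClasses (powPeriod (prodPeriod Φ₁ Φ₂) k) p := by
  haveI := nonempty_of_finrank_pos₁₂₈ Φ₁ (by omega)
  haveI := nonempty_of_finrank_pos₁₂₈ Φ₂ (by omega)
  exact hT.forall_divisorClasses_powPeriod_prod_eq_hodgeClasses_of_endAlgRat_eq_bot_of_card_sq_le Φ₂ hE₁
    (hT.forall_divisorClasses_eq_hodgeClasses_powPeriod_of_finrank_eq_three_of_endAlgRat_eq_bot h3 hE₁)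
    (card_sq_le_of_finrank_eq_two_of_finrank_eq_three Φ₂ h2 h3)
    (hS.forall_divisorClasses_powPeriod_eq_hodgeClasses_of_finrank_eq_two h2)

omit [FiniteDimensional ℂ E₂] in
/-- **`Hom_ℚ(T, S) = 0 = Hom_ℚ(S, T)`** for every abelian threefold `T` with `End_ℚ(T) = ℚ` and every complex torus `S` of
dimension `2`. [cite: MoonenZarhin1999LowDim, §3 (3.1) and Prop. (3.8)] [cite: Gordon1997, §2.16 Proposition]
[cite: Lange2023AbelianVarietiesComplex, §2.4.4 Cor. 2.4.26] -/
theorem IsAbelianVariety.homRat_eq_bot_and_of_finrank_eq_three_of_endAlgRat_eq_bot_of_finrank_eq_two [FiniteDimensional ℂ E₂]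
    (hT : IsAbelianVariety Φ₁) (h3 : finrank ℂ E₁ = 3) (hE₁ : endAlgRat Φ₁ = ⊥) (h2 : finrank ℂ E₂ = 2) :
    homRat Φ₁ Φ₂ = ⊥ ∧ homRat Φ₂ Φ₁ = ⊥ := by
  haveI := nonempty_of_finrank_pos₁₂₈ Φ₁ (by omega)
  haveI := nonempty_of_finrank_pos₁₂₈ Φ₂ (by omega)
  exact hT.homRat_eq_bot_and_of_endAlgRat_eq_bot_of_card_sq_le Φ₂ hE₁
    (hT.forall_divisorClasses_eq_hodgeClasses_powPeriod_of_finrank_eq_three_of_endAlgRat_eq_bot h3 hE₁)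
    (card_sq_le_of_finrank_eq_two_of_finrank_eq_three Φ₂ h2 h3)

/-- **`ρ(T × S) = 1 + ρ(S)`** for every abelian threefold `T` with `End_ℚ(T) = ℚ` and every complex torus `S` of dimension `2`
(so `ρ(T × S) ∈ {2, 3, 4, 5}` for abelian `S`). [cite: HulekLaface2019PicardNumbersAV, §2.1 Cor. 2.3] [cite: MoonenZarhin1999LowDim, §3 Prop. (3.8)] -/
theorem IsAbelianVariety.finrank_neronSeveriGroup_prod_of_finrank_eq_three_of_endAlgRat_eq_bot_of_finrank_eq_two
    (hT : IsAbelianVariety Φ₁) (h3 : finrank ℂ E₁ = 3) (hE₁ : endAlgRat Φ₁ = ⊥) (h2 : finrank ℂ E₂ = 2) :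
    finrank ℤ (neronSeveriGroup (prodPeriod Φ₁ Φ₂)) = 1 + finrank ℤ (neronSeveriGroup Φ₂) := by
  haveI := nonempty_of_finrank_pos₁₂₈ Φ₁ (by omega)
  haveI := nonempty_of_finrank_pos₁₂₈ Φ₂ (by omega)
  exact hT.finrank_neronSeveriGroup_prod_eq_one_add_of_endAlgRat_eq_bot_of_zdim_lt Φ₂ hE₁
    (hT.forall_divisorClasses_eq_hodgeClasses_powPeriod_of_finrank_eq_three_of_endAlgRat_eq_bot h3 hE₁)
    (zdim_lt_of_card_sq_le₁₂₈ Φ₂ (card_sq_le_of_finrank_eq_two_of_finrank_eq_three Φ₂ h2 h3))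

variable {κ : Type*} [Fintype κ] [DecidableEq κ] {E' : Type u} [NormedAddCommGroup E'] [InnerProductSpace ℂ E']
  [FiniteDimensional ℂ E'] [MeasurableSpace E'] [BorelSpace E'] (Ψ : (κ → ℝ) ≃L[ℝ] E') {q : ℕ} (e : Fin q ≃ κ)

/-- **THE HODGE `(p,p)`-CONJECTURE IN CYCLE FORM FOR EVERY INNER-PRODUCT TORUS ISOGENOUS TO A POWER OF `T × S`**, `T` any
abelian threefold with `End_ℚ(T) = ℚ`, `S` any abelian surface: `Aᵖ(Y) = Bᵖ(Y)` in every codimension.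
[cite: MoonenZarhin1999LowDim, Thm. (0.3) (4) and §1 (1.5)] [cite: Lange2023AbelianVarietiesComplex, §7.3.1 (p. 336) and §7.3.3 Exercise (1)(b)] -/
theorem IsIsogenous.forall_analyticClasses_eq_hodgeClasses_of_powPeriod_prod_of_finrank_eq_three_of_endAlgRat_eq_bot_of_finrank_eq_two
    {k : ℕ} (hY : IsIsogenous Ψ (powPeriod (prodPeriod Φ₁ Φ₂) k)) (hT : IsAbelianVariety Φ₁) (h3 : finrank ℂ E₁ = 3)
    (hE₁ : endAlgRat Φ₁ = ⊥) (hS : IsAbelianVariety Φ₂) (h2 : finrank ℂ E₂ = 2) (p : ℕ) :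
    analyticClasses Ψ e p = hodgeClasses Ψ p :=
  hY.forall_analyticClasses_eq_hodgeClasses_of_powPeriod_of_forall_powPeriod Ψ e (hT.prod hS)
    (hT.forall_divisorClasses_powPeriod_prod_eq_hodgeClasses_of_finrank_eq_three_of_endAlgRat_eq_bot_of_finrank_eq_two Φ₂
      h3 hE₁ hS h2) p

/-- The cycle form for inner-product tori `Y ∼ Tᵃ × Sᵇ`. [cite: MoonenZarhin1999LowDim, Thm. (0.3) (4) and §1 (1.5)]
[cite: Gordon1999HodgeAVSurvey, 7.6.1] [cite: Lange2023AbelianVarietiesComplex, §7.3.1 (p. 336)] -/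
theorem IsIsogenous.forall_analyticClasses_eq_hodgeClasses_of_prod_powPeriod_of_finrank_eq_three_of_endAlgRat_eq_bot_of_finrank_eq_two
    {a b : ℕ} (hY : IsIsogenous Ψ (prodPeriod (powPeriod Φ₁ a) (powPeriod Φ₂ b))) (hT : IsAbelianVariety Φ₁)
    (h3 : finrank ℂ E₁ = 3) (hE₁ : endAlgRat Φ₁ = ⊥) (hS : IsAbelianVariety Φ₂) (h2 : finrank ℂ E₂ = 2) (p : ℕ) :
    analyticClasses Ψ e p = hodgeClasses Ψ p :=
  hY.forall_analyticClasses_eq_hodgeClasses_of_prod_powPeriod_of_forall_powPeriod Ψ e hT hS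
    (hT.forall_divisorClasses_powPeriod_prod_eq_hodgeClasses_of_finrank_eq_three_of_endAlgRat_eq_bot_of_finrank_eq_two Φ₂
      h3 hE₁ hS h2) p

end Threefold

/-! ## §4 Against an elliptic curve: `T × E_τ` (Moonen–Zarhin Thm. (0.2)(4)) and every Hodge-general `X₁` of dimension `≥ 2` -/

section Elliptic

variable {ι₁ : Type*} [Fintype ι₁] [DecidableEq ι₁] {E₁ : Type*} [NormedAddCommGroup E₁] [NormedSpace ℂ E₁]
  [FiniteDimensional ℂ E₁] {Φ₁ : (ι₁ → ℝ) ≃L[ℝ] E₁} {τ : ℂ} (hτ : τ.im ≠ 0)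

omit [FiniteDimensional ℂ E₁] in
/-- `2² = 4 ≤ g₁(2g₁+1)` for `g₁ ≥ 2`: an elliptic curve is a small factor against anything of dimension `≥ 2`. [folklore]
[cite: Lange2023AbelianVarietiesComplex, §1.1.2 (p. 18)] -/
theorem card_fin_two_sq_le_of_two_le_finrank (h2 : 2 ≤ finrank ℂ E₁) :
    Fintype.card (Fin 2) ^ 2 ≤ finrank ℂ E₁ * (2 * finrank ℂ E₁ + 1) := by
  rw [Fintype.card_fin]
  nlinarith

/-- **A STABLY NONDEGENERATE ABELIAN VARIETY `X₁` OF DIMENSION `≥ 2` WITH `End_ℚ(X₁) = ℚ`, TIMES ANY ELLIPTIC CURVE `E_τ`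
(with or without complex multiplication): (D) on all powers of `X₁ × E_τ`** (Tate: `E_τ` satisfies (D); `dim Hg(E_τ) ≤ 3 <
10 ≤ g₁(2g₁+1)`). [cite: MoonenZarhin1999LowDim, §3 (3.1), Thm. (3.2) (1) and Cor. (3.9)] [cite: Gordon1999HodgeAVSurvey, Thm. 7.5 and Thm. 7.6.2]
[cite: Lange2023AbelianVarietiesComplex, §7.3.3 Exercise (3)(a)] -/
theorem IsAbelianVariety.forall_divisorClasses_powPeriod_prod_ellipticPeriod_eq_hodgeClasses_of_endAlgRat_eq_bot
    (hA₁ : IsAbelianVariety Φ₁) (hE₁ : endAlgRat Φ₁ = ⊥)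
    (hX₁ : ∀ k p, divisorClasses (powPeriod Φ₁ k) p = hodgeClasses (powPeriod Φ₁ k) p) (h2 : 2 ≤ finrank ℂ E₁) :
    ∀ k p, divisorClasses (powPeriod (prodPeriod Φ₁ (ellipticPeriod hτ)) k) p =
      hodgeClasses (powPeriod (prodPeriod Φ₁ (ellipticPeriod hτ)) k) p := by
  haveI := nonempty_of_finrank_pos₁₂₈ Φ₁ (by omega)
  exact hA₁.forall_divisorClasses_powPeriod_prod_eq_hodgeClasses_of_endAlgRat_eq_bot_of_card_sq_le (ellipticPeriod hτ) hE₁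
    hX₁ (card_fin_two_sq_le_of_two_le_finrank h2) (fun k p ↦ divisorClasses_eq_hodgeClasses_ellipticPow hτ k p)

/-- **`Hom_ℚ(X₁, E_τ) = 0` and `ρ(X₁ × E_τ) = 2`** for such an `X₁` and any elliptic curve.
[cite: HulekLaface2019PicardNumbersAV, §2.1 Cor. 2.3] [cite: MoonenZarhin1999LowDim, §3 Prop. (3.8)] -/
theorem IsAbelianVariety.homRat_ellipticPeriod_eq_bot_and_finrank_neronSeveriGroup_of_endAlgRat_eq_bot
    (hA₁ : IsAbelianVariety Φ₁) (hE₁ : endAlgRat Φ₁ = ⊥)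
    (hX₁ : ∀ k p, divisorClasses (powPeriod Φ₁ k) p = hodgeClasses (powPeriod Φ₁ k) p) (h2 : 2 ≤ finrank ℂ E₁) :
    homRat Φ₁ (ellipticPeriod hτ) = ⊥ ∧ finrank ℤ (neronSeveriGroup (prodPeriod Φ₁ (ellipticPeriod hτ))) = 2 := by
  haveI := nonempty_of_finrank_pos₁₂₈ Φ₁ (by omega)
  have hlt := zdim_lt_of_card_sq_le₁₂₈ (ellipticPeriod hτ) (card_fin_two_sq_le_of_two_le_finrank h2)
  refine ⟨hA₁.homRat_eq_bot_of_endAlgRat_eq_bot_of_zdim_lt (ellipticPeriod hτ) hE₁ hX₁ hlt, ?_⟩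
  rw [hA₁.finrank_neronSeveriGroup_prod_eq_one_add_of_endAlgRat_eq_bot_of_zdim_lt (ellipticPeriod hτ) hE₁ hX₁ hlt,
    finrank_neronSeveriGroup_eq_one_of_finrank_eq_one (ellipticPeriod hτ) (finrank_self ℂ)]

/-- **EVERY ABELIAN THREEFOLD `T` WITH `End_ℚ(T) = ℚ`, TIMES EVERY ELLIPTIC CURVE `E_τ`: (D) on all powers of the abelian
fourfold `T × E_τ`** — Moonen–Zarhin Thm. (0.2)(4) for these fourfolds (not case (a): "`X₁` is an elliptic curve with complex
multiplication by an imaginary quadratic field `k` and … there exists an embedding `k ↪ End⁰(X₂)`" is impossible for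
`End⁰(T) = ℚ`; (b)–(d) are simple). [cite: MoonenZarhin1999LowDim, Thm. (0.2) (4) (p0001 L124–L152), §2 (2.3) and §3 (3.1), Thm. (3.2) (1)]
[cite: Gordon1999HodgeAVSurvey, Thm. 6.3, Thm. 7.5 and Thm. 7.6.2] [cite: Lange2023AbelianVarietiesComplex, §7.3.3 Exercise (2)(c) and (3)(a)] -/
theorem IsAbelianVariety.forall_divisorClasses_powPeriod_prod_ellipticPeriod_eq_hodgeClasses_of_finrank_eq_three_of_endAlgRat_eq_bot
    (hT : IsAbelianVariety Φ₁) (h3 : finrank ℂ E₁ = 3) (hE₁ : endAlgRat Φ₁ = ⊥) :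
    ∀ k p, divisorClasses (powPeriod (prodPeriod Φ₁ (ellipticPeriod hτ)) k) p =
      hodgeClasses (powPeriod (prodPeriod Φ₁ (ellipticPeriod hτ)) k) p :=
  hT.forall_divisorClasses_powPeriod_prod_ellipticPeriod_eq_hodgeClasses_of_endAlgRat_eq_bot hτ hE₁
    (hT.forall_divisorClasses_eq_hodgeClasses_powPeriod_of_finrank_eq_three_of_endAlgRat_eq_bot h3 hE₁) (by omega)

/-- **`Hom_ℚ(T, E_τ) = 0` and `ρ(T × E_τ) = 2`** for every abelian threefold with `End_ℚ(T) = ℚ` and every elliptic curve.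
[cite: HulekLaface2019PicardNumbersAV, §2.1 Cor. 2.3] [cite: MoonenZarhin1999LowDim, §3 Prop. (3.8)] -/
theorem IsAbelianVariety.homRat_ellipticPeriod_eq_bot_and_finrank_neronSeveriGroup_of_finrank_eq_three_of_endAlgRat_eq_bot
    (hT : IsAbelianVariety Φ₁) (h3 : finrank ℂ E₁ = 3) (hE₁ : endAlgRat Φ₁ = ⊥) :
    homRat Φ₁ (ellipticPeriod hτ) = ⊥ ∧ finrank ℤ (neronSeveriGroup (prodPeriod Φ₁ (ellipticPeriod hτ))) = 2 :=
  hT.homRat_ellipticPeriod_eq_bot_and_finrank_neronSeveriGroup_of_endAlgRat_eq_bot hτ hE₁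
    (hT.forall_divisorClasses_eq_hodgeClasses_powPeriod_of_finrank_eq_three_of_endAlgRat_eq_bot h3 hE₁) (by omega)

variable {κ : Type*} [Fintype κ] [DecidableEq κ] {E' : Type u} [NormedAddCommGroup E'] [InnerProductSpace ℂ E']
  [FiniteDimensional ℂ E'] [MeasurableSpace E'] [BorelSpace E'] (Ψ : (κ → ℝ) ≃L[ℝ] E') {q : ℕ} (e : Fin q ≃ κ)

/-- **The Hodge `(p,p)`-conjecture in cycle form for every inner-product torus isogenous to a power of `T × E_τ`**, `T` any
abelian threefold with `End_ℚ(T) = ℚ`, `E_τ` any elliptic curve. [cite: MoonenZarhin1999LowDim, Thm. (0.2) (4) and §1 (1.5)]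
[cite: Lange2023AbelianVarietiesComplex, §7.3.1 (p. 336) and §7.3.3 Exercise (1)(b)] -/
theorem IsIsogenous.forall_analyticClasses_eq_hodgeClasses_of_powPeriod_prod_ellipticPeriod_of_finrank_eq_three_of_endAlgRat_eq_bot
    {k : ℕ} (hY : IsIsogenous Ψ (powPeriod (prodPeriod Φ₁ (ellipticPeriod hτ)) k)) (hT : IsAbelianVariety Φ₁)
    (h3 : finrank ℂ E₁ = 3) (hE₁ : endAlgRat Φ₁ = ⊥) (p : ℕ) : analyticClasses Ψ e p = hodgeClasses Ψ p :=
  hY.forall_analyticClasses_eq_hodgeClasses_of_powPeriod_of_forall_powPeriod Ψ e (hT.prod (isAbelianVariety_ellipticPeriod hτ))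
    (hT.forall_divisorClasses_powPeriod_prod_ellipticPeriod_eq_hodgeClasses_of_finrank_eq_three_of_endAlgRat_eq_bot hτ h3
      hE₁) p

/-- The cycle form for inner-product tori isogenous to a power of `X₁ × E_τ`, `X₁` stably nondegenerate abelian of dimension
`≥ 2` with `End_ℚ(X₁) = ℚ`. [cite: MoonenZarhin1999LowDim, §1 (1.5), §3 (3.1) and Cor. (3.9)] [cite: Lange2023AbelianVarietiesComplex, §7.3.1 (p. 336)] -/
theorem IsIsogenous.forall_analyticClasses_eq_hodgeClasses_of_powPeriod_prod_ellipticPeriod_of_endAlgRat_eq_bot {k : ℕ}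
    (hY : IsIsogenous Ψ (powPeriod (prodPeriod Φ₁ (ellipticPeriod hτ)) k)) (hA₁ : IsAbelianVariety Φ₁) (hE₁ : endAlgRat Φ₁ = ⊥)
    (hX₁ : ∀ k p, divisorClasses (powPeriod Φ₁ k) p = hodgeClasses (powPeriod Φ₁ k) p) (h2 : 2 ≤ finrank ℂ E₁) (p : ℕ) :
    analyticClasses Ψ e p = hodgeClasses Ψ p :=
  hY.forall_analyticClasses_eq_hodgeClasses_of_powPeriod_of_forall_powPeriod Ψ e (hA₁.prod (isAbelianVariety_ellipticPeriod hτ))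
    (hA₁.forall_divisorClasses_powPeriod_prod_ellipticPeriod_eq_hodgeClasses_of_endAlgRat_eq_bot hτ hE₁ hX₁ h2) p

end Elliptic

end ComplexTorus

end Literature.Geometry.Kaehler

end
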